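import Mathlib
import Summits.ValiantsHypothesis.ValiantsHypothesis.Theorems.LacunarySymmetroidMatrixDescartesCensusDoorA

/-!
# `MatrixDescartes` census — `3 × 3`: symmetric, Hermitian and general letters differ by the sign of ONE quadratic term

HONEST FRAMING.  Object-search cell `pub-symmetroid`, item `DoorA34 = PosRootLawAt 3 4 18`
(stmt-ValiantsHypothesis-19980; OPEN, typed, never asserted).  Two `3 × 3` determinant identities, for the
record of the `(3,4)` door's METHOD discussion; nothing is decided.  Nothing here bears on `MatrixDescartes`
(stmt-ValiantsHypothesis-18050) or `VP ≠ VNP`.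

Every real `3 × 3` matrix is `A + [b]ₓ` (`A` symmetric, `[b]ₓ` the cross-product matrix of `b ∈ ℝ³`), every
complex-Hermitian one is `A + i[b]ₓ`; and

* `det_add_crossMatrix` — `det(A + [b]ₓ) = det A + bᵀAb` (`A` symmetric);
* `det_add_I_crossMatrix` — `det(A + i[b]ₓ) = det A − bᵀAb` (`A` symmetric; the value is real).

So for a four-term pencil with symmetric parts `A(x) = Σ x^{d_l}A_l` and skew parts `b(x) = Σ x^{d_l} b_l` the
three columns of the census are ONE family `det A(x) + τ·b(x)ᵀA(x)b(x)`: `τ = +1` GENERAL real letters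
(`19 = D(3,4)` attained, `Census.G3K4E1`), `τ = 0` SYMMETRIC letters (`DoorA34`: `≤ 18` conjectured, `18`
attained), `τ = −1` complex-HERMITIAN letters (whether `19` is attained is NOT known to the cell; if it is,
every argument for `DoorA34` that is valid for Hermitian pencils — interlacing, inertia, quadratic-form ray
laws — is void, as the four-squares twenty voids them at `(2,6)`, `…CensusFourSquares`).

[folklore] Cofactor expansion.
-/

-- `Summit.ValiantsHypothesis.ValiantsHypothesis.…` repeats a component by the D-0017 layout
-- (single-conjunct summit), which the `dupNamespace` linter flags; the name is mandated.
set_option linter.dupNamespace false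

namespace Summit.ValiantsHypothesis.ValiantsHypothesis.Theorems.LacunarySymmetroidMatrixDescartes.Census.SkewParts

open scoped Matrix

/-- **General real `3 × 3` = symmetric + cross matrix:** `det(A + [b]ₓ) = det A + bᵀAb` for symmetric `A`.
[folklore] -/
theorem det_add_crossMatrix (A : Matrix (Fin 3) (Fin 3) ℝ) (hA : A.IsSymm) (b : Fin 3 → ℝ) :
    (A + !![0, -b 2, b 1; b 2, 0, -b 0; -b 1, b 0, 0]).det = A.det + b ⬝ᵥ A *ᵥ b := by
  have h10 := hA.apply 0 1; have h20 := hA.apply 0 2; have h21 := hA.apply 1 2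
  simp [Matrix.det_fin_three, dotProduct, Matrix.mulVec, Fin.sum_univ_three, h10, h20, h21]
  ring

/-- **Complex-Hermitian `3 × 3` = symmetric + `i`·cross matrix:** `det(A + i[b]ₓ) = det A − bᵀAb` for real
symmetric `A` and real `b` (in particular the determinant is real). [folklore] -/
theorem det_add_I_crossMatrix (A : Matrix (Fin 3) (Fin 3) ℝ) (hA : A.IsSymm) (b : Fin 3 → ℝ) :
    (A.map ((↑) : ℝ → ℂ) + Complex.I • (!![0, -b 2, b 1; b 2, 0, -b 0; -b 1, b 0, 0] :
        Matrix (Fin 3) (Fin 3) ℝ).map ((↑) : ℝ → ℂ)).det = ((A.det - b ⬝ᵥ A *ᵥ b : ℝ) : ℂ) := by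
  have h10 := hA.apply 0 1; have h20 := hA.apply 0 2; have h21 := hA.apply 1 2
  simp [Matrix.det_fin_three, dotProduct, Matrix.mulVec, Fin.sum_univ_three, h10, h20, h21]
  ring_nf
  simp only [Complex.I_sq]
  ring

/-- The Hermitian letter `A + i[b]ₓ` is indeed Hermitian (conjugate transpose = itself). [folklore] -/
theorem isHermitian_add_I_crossMatrix (A : Matrix (Fin 3) (Fin 3) ℝ) (hA : A.IsSymm) (b : Fin 3 → ℝ) :
    (A.map ((↑) : ℝ → ℂ) + Complex.I • (!![0, -b 2, b 1; b 2, 0, -b 0; -b 1, b 0, 0] :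
        Matrix (Fin 3) (Fin 3) ℝ).map ((↑) : ℝ → ℂ)).IsHermitian := by
  have h10 := hA.apply 0 1; have h20 := hA.apply 0 2; have h21 := hA.apply 1 2
  refine Matrix.IsHermitian.ext fun i j => ?_
  fin_cases i <;> fin_cases j <;>
    simp [Matrix.add_apply, Matrix.smul_apply, Matrix.map_apply, h10, h20, h21]

end Summit.ValiantsHypothesis.ValiantsHypothesis.Theorems.LacunarySymmetroidMatrixDescartes.Census.SkewParts
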